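import Summits.QuantumFields.YangMills.Theorems.UnitScaleTiltProp7HN06OfPatch
import Summits.QuantumFields.YangMills.Theorems.UnitScaleTiltProp7DivRecoveryPatchRows
import HarnessLib

/-!
# Prop. 7 on T³ — LANE II CLOSED BY KERNEL: `hN06` HOLDS (the N06 socket of the E′ growth side, hypothesis-free up to the display letters `c₀ cB a₀`)

Route `UnitScaleTilt`, crux «MinimiserStabilityRegPr» (stmt-QuantumFields-19200), EX stub `stub_existenceMinimalOrbit`, lane II «divergence recovery at the curved printed-regular
member» (★★OWNER RULING №23; lane-II namer ★p1 g17–g20).  `hN06_holds := hN06_of_patchRows (patch_rows (hQH1_of_sectors H_door hH0_doorH hHsplit_doorH (h𝔰𝔲_doorH_of_rlegs rlegs_of_regPr)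
(hcen_doorH_of_flat hcen_one)))` — the terminal knit ✓p725152 fed with PATCHES1 ✓`Prop7DivRecoveryPatchRows.patch_rows` (px9 g8 over w1-19200 g16's CORE ✓p724377, px4 g9's FEEDS,
px9's PEEL bricks, px11∕px12∕px21∕px22∕px10∕px19∕px18∕px3∕routeR suppliers — see those files' docstrings) and the (QH1)♮ door ✓p718170 at `H := H_door` with its three sector rows by name.
After this file the EX display carries NO lane-II row: `hN06 := hN06_holds c₀ cB a₀ ha₀`.

HONEST SCOPE.  A composition by name of landed theorems; the N06 PRINT rows, `hThm2S` and the numeral rows of the EX face are untouched; nothing of EX `stub_existenceMinimalOrbit`∕the crux is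
proved here.  YM₃ on T³ is rung R3 — NOT d = 4, NOT infinite volume, NOT a mass gap, NOT Clay.  THEOREMS ONLY (0 `def`, 0 `sorry`); `--supports stmt-QuantumFields-19200 --as helper`, count-neutral.
References: T. Bałaban, CMP **99** (1985) 389–434 [Balaban1985BackgroundPropagators] (Thm 3.11 p.416, (3.26) p.395, (3.100) pp.413–414); CMP **98** (1985) 17–51 [Balaban1985Averaging].
-/

set_option autoImplicit false

noncomputable section

open scoped InnerProductSpace ComplexConjugate BigOperators Matrix.Norms.L2Operator

namespace Summit.QuantumFields.YangMills.Theorems.Prop7HN06Holds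

open Literature.MathematicalPhysics.QuantumFieldTheory.Balaban1983to89
open Literature.MathematicalPhysics.QuantumFieldTheory.Balaban1983to89.T3ContinuumYM3Torus
open T3PrintedRegularMinimiser (RegPr)
open B9TorusCalculus (torusT)
open B9Eq39Adjoint (curl)
open B10Eq27TorusAxialLog (unitsField toUField)
open B11Eq103H1Complex (SiteL2K BondL2K laplaceAK)
open Summit.QuantumFields.YangMills.Theorems.Prop7SectET3Transport (periodsT3)
open Summit.QuantumFields.YangMills.Theorems.Prop7SectET3HilbertLetters (W₂ toL2 DL2 DstarL2 covLapSite)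
open Summit.QuantumFields.YangMills.Theorems.Prop7SectET3WilsonHessian (DeltaEtaSlot)
open Summit.QuantumFields.YangMills.Theorems.Prop7SectET3CombLetters (Qkc)
open Summit.QuantumFields.YangMills.Theorems.Prop7QprimeCombL2 (RcombL2)
open Summit.QuantumFields.YangMills.Theorems.Prop7HN06OfPatch (hN06_of_patchRows)
open Summit.QuantumFields.YangMills.Theorems.Prop7DivRecoveryPatchRows (patch_rows)
open Summit.QuantumFields.YangMills.Theorems.Prop7RLegsLinTowerRowsT3 (rlegs_of_regPr)
open Summit.QuantumFields.YangMills.Theorems.Prop7QH1OfSectors (hQH1_of_sectors)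
open Summit.QuantumFields.YangMills.Theorems.Prop7QH1SectorRowsOfH (hHsplit_doorH hH0_doorH)
open Summit.QuantumFields.YangMills.Theorems.Prop7QH1SuRowOfRLegs (h𝔰𝔲_doorH_of_rlegs)
open Summit.QuantumFields.YangMills.Theorems.Prop7QH1CentralOfFlat (hcen_doorH_of_flat)
open Summit.QuantumFields.YangMills.Theorems.Prop7QH1CentralRowFlat (hcen_one)

variable (c₀ cB a₀ : ℕ → ℝ) [hc₀ : ∀ L : ℕ, Fact (0 < c₀ L)] [hcB : ∀ L : ℕ, Fact (0 < cB L)]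

/-- ★★★★ **LANE II CLOSED — `hN06` HOLDS**: for the weights `c₀ cB > 0` and `a₀ > 0` (member-uniform at each `L`), at every printed-regular member `RegPr F n K e W` with
`0 < e ≤ eN(L)` the full-Landau operator `laplaceAK(Δ^η_W, D_W, R_comb,W, D*_W, Q_k^c, (Q_k^c)*, a₀(c₀∕cB)ℓ³)` has a right inverse `G₀` with `‖G₀ f‖ ≤ B₀(L)‖f‖` — [Balaban1985BackgroundPropagators]
Thm 3.11's conclusion for the route's comb operator, by the lane-II divergence-recovery programme (door ✓p702330, terminal knit ✓p725152, PATCHES1 ✓`patch_rows`, the (QH1)♮ sector door at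
`H := H_door`).  [cite: Balaban1985BackgroundPropagators, Thm 3.11 p.416, (3.26) p.395, (3.100) pp.413-414; Balaban1985Averaging, (110)-(112) p.34] -/
theorem hN06_holds (ha₀ : ∀ L, 1 < L → 0 < a₀ L) :
    ∀ (L : ℕ), 1 < L → ∃ B₀ eN : ℝ, 0 < B₀ ∧ 0 < eN ∧
      ∀ (F : T3Family), F.L = L → ∀ (n K : ℕ) (hnK : n < K) (e : ℝ) (W : GaugeField (F.P K) 0 (Matrix.specialUnitaryGroup (Fin 2) ℂ)),
        0 < e → e ≤ eN → RegPr F n K e W →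
        ∃ G₀ : BondL2K ℂ 3 (periodsT3 F K) (c₀ F.L) W₂ →ₗ[ℂ] BondL2K ℂ 3 (periodsT3 F K) (c₀ F.L) W₂,
          laplaceAK (DeltaEtaSlot F n K (c₀ F.L) W) (DL2 F n K (c₀ F.L) W) (RcombL2 F n K (c₀ F.L) W) (DstarL2 F n K (c₀ F.L) W)
              (Qkc F n K hnK.le (c₀ F.L) (cB F.L) W) (LinearMap.adjoint (Qkc F n K hnK.le (c₀ F.L) (cB F.L) W))
              (((a₀ F.L * (c₀ F.L / cB F.L) * ((F.L : ℝ) ^ (K - n)) ^ 3 : ℝ) : ℂ)) ∘ₗ G₀ = LinearMap.id ∧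
          ∀ f, ‖G₀ f‖ ≤ B₀ * ‖f‖ :=
  hN06_of_patchRows c₀ cB a₀ ha₀
    (patch_rows c₀ cB
      (hQH1_of_sectors c₀ cB
        (fun (F : T3Family) (n K : ℕ) (W : GaugeField (F.P K) 0 (Matrix.specialUnitaryGroup (Fin 2) ℂ)) (f : BondL2K ℂ 3 (periodsT3 F K) (c₀ F.L) W₂) =>
      c₀ F.L * ((F.L : ℝ) ^ (K - n)) ^ 2 * (∑ x : Site (F.P K) 0, ∑ μ : Fin (F.P K).d, ∑ ν : Fin (F.P K).d,
      (if μ < ν then ∑ j : Fin 2, ∑ k : Fin 2,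
      ‖(curl (torusT (F.P K) 0) (fun κ z => unitsField (toUField W) ⟨z, κ⟩) (fun κ z => (toL2 F K (c₀ F.L)).symm f ⟨z, κ⟩) μ ν x) j k‖ ^ 2 else 0))
      + ‖DstarL2 F n K (c₀ F.L) W f‖ ^ 2)
        (hH0_doorH c₀) (hHsplit_doorH c₀) (h𝔰𝔲_doorH_of_rlegs c₀ cB rlegs_of_regPr) (hcen_doorH_of_flat c₀ cB (hcen_one c₀ cB))))

end Summit.QuantumFields.YangMills.Theorems.Prop7HN06Holds

end
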